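import Mathlib
import Summits.PneNP.PneNP.Theses.OneSlice
import Summits.PneNP.PneNP.Theorems.OneSliceSliceTargetSplitTransport

/-!
# Sketch — crux-ideate stmt-PneNP-18471 (`MonotoneContinuation`), ideator 2, round 1

First lemmas of the three idea cards, stated over existing declarations (they need not be proved here):

* card A `ignition-profile-sandwich`: `ProfileSandwich` — the fixed-noise sampler of a MONOTONE circuit
  dominates / is dominated by the transport pointwise, with slice-wise `L¹` gap EXACTLY the increment of the
  acceptance profile `A_C` (= CDF of the ignition time of `C` along the random graph process).
* card B `pivotality-linearization`: `PivotalityBound` — first-order (Russo–Margulis) control of the transport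
  below the slice by the number of up-pivotal absent slots.
* card C `monotone-hardcore-boosting`: `MonotoneMajorityClosure` — the class of size-`s` monotone circuits is
  closed under `t`-fold majority at polynomial cost (the only circuit fact Impagliazzo's min-max proof uses).
-/

namespace Summit.PneNP.PneNP.Cruxes.MonotoneContinuation.Ideator2

open Literature.Computability.Complexity hiding supp mem_supp
open Finset hiding slice
open Classical
open Summit.PneNP.PneNP.Theorems.ConstantBand.Negative (Edge slice)
open Summit.PneNP.PneNP.Theorems.SliceTargetSplit (transport ind l1 nbhd)

noncomputable section

variable {n : ℕ}

/-- Acceptance profile of a circuit: the fraction of slice `i` it accepts (`A_C(i)`; for monotone `C` this is the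
CDF at `i` of the ignition time of `C` along the random graph process). [folklore] -/
def profile (C : Circuit (Edge n)) (i : ℕ) : ℝ :=
  (#((slice n i).filter fun x => C.eval x = true) : ℝ) / (#(slice n i) : ℝ)

/-- **Card A, first lemma (ProfileSandwich).** For a monotone circuit `C`, weights `i ≤ j ≤ j'` and `y` on slice
`i`: the transport from slice `j'` (= the exact up-noise sampler `U_{j'-i}` at `y`) dominates the transport from
slice `j` pointwise, and the slice-`i` average of the gap is exactly `A_C(j') - A_C(j)`. [folklore] -/
def ProfileSandwich : Prop :=
  ∀ (n i j j' : ℕ) (C : Circuit (Edge n)), C.IsOver monotoneBasis → i ≤ j → j ≤ j' → j' ≤ n.choose 2 →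
    (∀ y ∈ slice n i, transport j (ind C.eval) y ≤ transport j' (ind C.eval) y) ∧
    (∑ y ∈ slice n i, (transport j' (ind C.eval) y - transport j (ind C.eval) y)) / (#(slice n i) : ℝ)
      = profile C j' - profile C j

/-- The number of up-pivotal absent slots of `C` at `y` (for `C y = false`: the slots whose addition ignites
`C`). [folklore] -/
def upPivotal (C : Circuit (Edge n)) (y : Edge n → Bool) : ℕ :=
  #(univ.filter fun e : Edge n => y e = false ∧ C.eval (Function.update y e true) = true)

/-- **Card B, first lemma (PivotalityBound).** Below the slice, non-ignition of a monotone circuit under the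
exact sprinkle is at most the probability that the sprinkle misses every pivotal slot:
`1 - (T_j 𝟙[C])(y) ≤ C(N-i-π, j-i) / C(N-i, j-i)` for `y` on slice `i ≤ j` with `C y = false`,
`π = upPivotal C y`, `N = C(n,2)`. [folklore] -/
def PivotalityBound : Prop :=
  ∀ (n i j : ℕ) (C : Circuit (Edge n)) (y : Edge n → Bool), C.IsOver monotoneBasis → y ∈ slice n i → i ≤ j →
    j ≤ n.choose 2 → C.eval y = false →
    1 - transport j (ind C.eval) y ≤
      (((n.choose 2 - i - upPivotal C y).choose (j - i) : ℕ) : ℝ) / (((n.choose 2 - i).choose (j - i) : ℕ) : ℝ)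

/-- **Card C, first lemma (MonotoneMajorityClosure).** Majority of `t` monotone circuits of size `≤ s` on the
edge variables is computed by a monotone circuit of size `≤ t * s + 4 * t ^ 2` (sorting network / iterated
thresholds; the only property of the circuit class used by the min-max proof of the hard-core lemma).
[cite: AroraBarak2009, Lemma 19.3] -/
def MonotoneMajorityClosure : Prop :=
  ∀ (n t s : ℕ) (Cs : Fin t → Circuit (Edge n)), (∀ a, (Cs a).IsOver monotoneBasis) → (∀ a, (Cs a).size ≤ s) →
    ∃ M : Circuit (Edge n), M.IsOver monotoneBasis ∧ M.size ≤ t * s + 4 * t ^ 2 ∧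
      ∀ y : Edge n → Bool, M.eval y = decide (t < 2 * #(univ.filter fun a : Fin t => (Cs a).eval y = true))

end

end Summit.PneNP.PneNP.Cruxes.MonotoneContinuation.Ideator2
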